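import Summits.CriticalPhenomena.PercolationContinuityZ3.Theorems.PercNearOneGluingNoHeavyLowerTailSwitchRelaxFinc19ChecksD
import HarnessLib

/-!
# Finite-relaxation replay of the clean switching certificate `Finc19`: kernel checks at input types (pieces `checkAt_4` … `checkAtY_6_5`)

Support file (prover prim-masterthm-p1 gen 2; `--supports stmt-CriticalPhenomena-4575`).  No named facts, no sorries.  Split from
`…SwitchRelaxFinc19` only to keep each file's kernel time small.
-/

namespace Summit.CriticalPhenomena.PercolationContinuityZ3.Theorems

namespace SwitchRelax

namespace Finc19

set_option maxHeartbeats 800000 in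
/-- Kernel evaluation of the finite relaxation at input type `4`. [this work] -/
theorem checkAt_4 : certFinc19.checkAt 4 = true := by decide +kernel

set_option maxHeartbeats 800000 in
/-- Kernel evaluation of the finite relaxation at input type `5`. [this work] -/
theorem checkAt_5 : certFinc19.checkAt 5 = true := by decide +kernel

/-- Kernel evaluation of the finite relaxation at input type `6`, `Y`-type `0`. [this work] -/
theorem checkAtY_6_0 : certFinc19.checkAtY 6 0 = true := by decide +kernel

/-- Kernel evaluation of the finite relaxation at input type `6`, `Y`-type `1`. [this work] -/
theorem checkAtY_6_1 : certFinc19.checkAtY 6 1 = true := by decide +kernel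

/-- Kernel evaluation of the finite relaxation at input type `6`, `Y`-type `2`. [this work] -/
theorem checkAtY_6_2 : certFinc19.checkAtY 6 2 = true := by decide +kernel

/-- Kernel evaluation of the finite relaxation at input type `6`, `Y`-type `3`. [this work] -/
theorem checkAtY_6_3 : certFinc19.checkAtY 6 3 = true := by decide +kernel

/-- Kernel evaluation of the finite relaxation at input type `6`, `Y`-type `4`. [this work] -/
theorem checkAtY_6_4 : certFinc19.checkAtY 6 4 = true := by decide +kernel

/-- Kernel evaluation of the finite relaxation at input type `6`, `Y`-type `5`. [this work] -/
theorem checkAtY_6_5 : certFinc19.checkAtY 6 5 = true := by decide +kernel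

end Finc19

end SwitchRelax

end Summit.CriticalPhenomena.PercolationContinuityZ3.Theorems
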